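import Summits.BirchSwinnertonDyer.BirchSwinnertonDyer.Theorems.SignedLowerHalvesKobayashiLowerHalfSemistableScopeAuxField
import HarnessLib

/-!
# Route `SignedLowerHalves`, crux `KobayashiLowerHalfSemistable` (item stmt-BirchSwinnertonDyer-19000): the rider (α)
# is equally void at `p = 3` — the crux BY NAME from the two S-SCOPED tiers (inline) and TWO published facts, with
# NEITHER a class-number statement NOR Bhargava–Varma 2016 (cell `bsd-ssimc`, seat `bsd-ssimc-bstw` gen 9, bstw-MEMO-9
# addendum B; a `--supports … --as helper` file; THEOREMS ONLY; closes nothing)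

PARTITION (cell bsd-ssimc, D-0054): X6 ∧ r = 0 (A6) × 13 (+10~) × p ∈ {3, 5} + X6 r1 + literal row D2 — types-the-object-of;
closes NONE. HONEST FRAMING: nothing here proves Kobayashi's conjecture for any curve; the two S-scoped readings of the
UNREFEREED preprint BSTW (arXiv:2409.01350v2 Thm 1.3) at `p ≥ 5` and at `p = 3` enter ONLY as displayed hypotheses
(`hS5`, `hS3`); the `p = 3` reading rests in addition on the preprint [SV-S-Ohta] (residual (3-ii)♭, REPORT-bstw-7); BSD is
not proved by any of this; the item stays OPEN.

Why this file. bstw-MEMO-9 shows that the class-number rider (α) of the cell-verified reading is void at `p ≥ 5`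
(Γ_L = Γ_L^cyc × Γ_L^v for every auxiliary `L`, any odd `p`). The SAME lemma holds at `p = 3`, and the `p = 3` tier binder
of record (`BurungaleSkinnerTianWan2024_thm13_scopedAtThree_OPEN`, k3-c2) carries the same scope witness
`BSTWScope.HasWitness W 3` (with `3 ∤ h_L`), which k3-c2 discharged class-wide from Bhargava–Varma 2016 Cor. 4(a).
With (α) void at 3 as well, the class-number-free witness (`BSTWScope_exists_auxField_of_goodSS`, a theorem at every odd
`p`) suffices, so Bhargava–Varma leaves the dependency list of crux 2: `KobayashiLowerHalfSemistable` BY NAME ⟸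
{S-scoped tier at `p ≥ 5` (`hS5`), S-scoped tier at `p = 3` (`hS3`), modularity, Diamond 1995 / Ribet 1990}.
Whether the (α)-free readings ARE the cell's verified readings is the referee's to grade (REPORT-bstw-9); here they are
displayed hypotheses. References: [BurungaleSkinnerTianWan2024] Thm. 1.3 (PRE); [Kobayashi2003] Conjecture (p. 2);
[Ribet1990] Thm. 1.1; [Diamond1995RefinedSerre] Thm. 1.1; cell records bstw-MEMO-9 (626211cba73919ef) + addA/addB.
-/

set_option autoImplicit false
set_option linter.dupNamespace false

noncomputable section

open scoped Classical

open WeierstrassCurve NumberField Literature.NumberTheory.EllipticCurves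
  Literature.NumberTheory.EllipticCurves.ModularForms
  Literature.NumberTheory.EllipticCurves.Rank1Residual
  Literature.NumberTheory.EllipticCurves.Rank1Residual.Typed
  Summit.BirchSwinnertonDyer.Rank1Residual.Supersingular

namespace Summit.BirchSwinnertonDyer.BirchSwinnertonDyer.Theorems

/-- **The crux BY NAME from the two S-SCOPED tiers (displayed INLINE) and TWO PUBLISHED facts — no class-number
statement, no Bhargava–Varma.** `hS5` = the cell-verified reading of BSTW Thm 1.3 at `p ≥ 5` with scope S1 ∧ S2 only;
`hS3` = the `p = 3` tier (BSTW's own clause, PRE on [SV-S-Ohta] = residual (3-ii)♭) with the same class-number-free scope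
(`a₃ = 0` displayed, as in the binder of record). The scope witnesses are supplied at every odd `p` by
`BSTWScope_exists_auxField_of_goodSS` (Dirichlet + CRT + decomposition law; (ram) prime by Ribet's level-lowering modulo
modularity `hmod` and Diamond/Ribet `hLL`). CONDITIONAL (`conditional-result`); the item stays OPEN.
[claim: BurungaleSkinnerTianWan2024, status: under-review] [cite: Kobayashi2003, Conjecture (Main Conjecture) (p. 2)]
[cite: Ribet1990, Thm. 1.1] [cite: Diamond1995RefinedSerre, Thm. 1.1] -/
theorem KobayashiLowerHalfSemistable_of_scopeS_of_scopeS3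
    (hS5 : ∀ (W : WeierstrassCurve ℚ) [W.IsElliptic] [W.IsGloballyMinimal] (p : ℕ) [Fact p.Prime],
      5 ≤ p → Semistable W → GoodSS W p →
      (∃ (q : ℕ) (_ : Fact q.Prime) (L : Type) (_ : Field L) (_ : NumberField L),
        BSTWScope.IsAuxiliaryPrime W p q ∧ BSTWScope.IsAuxiliaryField W p q L) →
      ∀ ε : ℤˣ, KobayashiMainConjecture W p ε)
    (hS3 : ∀ (W : WeierstrassCurve ℚ) [W.IsElliptic] [W.IsGloballyMinimal] (p : ℕ) [Fact p.Prime],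
      p = 3 → Semistable W → GoodSS W p → W.frobeniusTrace 3 = 0 →
      (∃ (q : ℕ) (_ : Fact q.Prime) (L : Type) (_ : Field L) (_ : NumberField L),
        BSTWScope.IsAuxiliaryPrime W p q ∧ BSTWScope.IsAuxiliaryField W p q L) →
      ∀ ε : ℤˣ, KobayashiMainConjecture W p ε)
    (hmod : exists_isNewformOf) (hLL : Literature.NumberTheory.Automorphic.diamond1995_refinedSerre) :
    Summit.BirchSwinnertonDyer.BirchSwinnertonDyer.Theses.SignedLowerHalves.KobayashiLowerHalfSemistable := by
  intro W _ _ p hpF hp hX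
  have hw := BSTWScope_exists_auxField_of_goodSS hmod hLL W p hp hX.2.1 hX.1
  by_cases h5 : 5 ≤ p
  · exact ⟨1, kobayashiLowerDivisibility_of_mainConjecture (hS5 W p h5 hX.2.1 hX.1 hw 1)⟩
  · have h2 := hpF.out.two_le
    have hlt : p < 5 := Nat.lt_of_not_le h5
    have ha3 : W.frobeniusTrace 3 = 0 := by
      rcases hX.2.2 with h5' | h0
      · exact absurd h5' h5
      · exact h0
    interval_cases p
    · exact absurd rfl hp
    · exact ⟨1, kobayashiLowerDivisibility_of_mainConjecture (hS3 W 3 rfl hX.2.1 hX.1 ha3 hw 1)⟩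
    · exact absurd hpF.out (by decide)

/-- The S-scoped reading at `p = 3` is IMPLIED by the printed claim (BSTW Thm 1.3 as printed). Sanity check.
[claim: BurungaleSkinnerTianWan2024, status: under-review] -/
theorem scopeS3_of_thm13_OPEN (h : BurungaleSkinnerTianWan2024_thm13_OPEN) :
    ∀ (W : WeierstrassCurve ℚ) [W.IsElliptic] [W.IsGloballyMinimal] (p : ℕ) [Fact p.Prime],
      p = 3 → Semistable W → GoodSS W p → W.frobeniusTrace 3 = 0 →
      (∃ (q : ℕ) (_ : Fact q.Prime) (L : Type) (_ : Field L) (_ : NumberField L),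
        BSTWScope.IsAuxiliaryPrime W p q ∧ BSTWScope.IsAuxiliaryField W p q L) →
      ∀ ε : ℤˣ, KobayashiMainConjecture W p ε := by
  intro W _ _ p _ h3 hsst hss ha3 _ ε
  exact h W p (by omega) hsst hss (fun _ => ha3) ε

/-- The S-scoped reading at `p = 3` IMPLIES the `p = 3` tier binder of record (whose witness additionally carries
`3 ∤ h_L`). [claim: BurungaleSkinnerTianWan2024, status: under-review] -/
theorem thm13_scopedAtThree_OPEN_of_scopeS3
    (hS3 : ∀ (W : WeierstrassCurve ℚ) [W.IsElliptic] [W.IsGloballyMinimal] (p : ℕ) [Fact p.Prime],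
      p = 3 → Semistable W → GoodSS W p → W.frobeniusTrace 3 = 0 →
      (∃ (q : ℕ) (_ : Fact q.Prime) (L : Type) (_ : Field L) (_ : NumberField L),
        BSTWScope.IsAuxiliaryPrime W p q ∧ BSTWScope.IsAuxiliaryField W p q L) →
      ∀ ε : ℤˣ, KobayashiMainConjecture W p ε) :
    BurungaleSkinnerTianWan2024_thm13_scopedAtThree_OPEN := by
  intro W _ _ p _ h3 hsst hss ha3 hw ε
  obtain ⟨q, hq, L, hF, hN, haux, hfield, _⟩ := hw
  exact hS3 W p h3 hsst hss ha3 ⟨q, hq, L, hF, hN, haux, hfield⟩ ε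

/-- **Conversely-shaped sanity check: the two tier binders OF RECORD give the two S-scoped readings on the pairs that
HAVE a full witness** — so on REPORT-bstw-9 PASS the only change is the scope of the hypotheses, not the conclusion.
Precisely: binder of record at `p ≥ 5` + the corner hypothesis `hα` (bstw-MEMO-9: every class-number-free pair has
`p ∣ h_L` ⟹ still KMC) give `hS5`. [claim: BurungaleSkinnerTianWan2024, status: under-review] -/
theorem scopeS_of_thm13_scoped_OPEN_of_hLCorner (hBSTW5 : BurungaleSkinnerTianWan2024_thm13_scoped_OPEN)
    (hα : ∀ (W : WeierstrassCurve ℚ) [W.IsElliptic] [W.IsGloballyMinimal] (p : ℕ) [Fact p.Prime],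
      5 ≤ p → Semistable W → GoodSS W p →
      (∀ (q : ℕ) (_ : Fact q.Prime) (L : Type) (_ : Field L) (_ : NumberField L),
        BSTWScope.IsAuxiliaryPrime W p q → BSTWScope.IsAuxiliaryField W p q L →
          p ∣ NumberField.classNumber L) →
      ∀ ε : ℤˣ, KobayashiMainConjecture W p ε) :
    ∀ (W : WeierstrassCurve ℚ) [W.IsElliptic] [W.IsGloballyMinimal] (p : ℕ) [Fact p.Prime],
      5 ≤ p → Semistable W → GoodSS W p →
      (∃ (q : ℕ) (_ : Fact q.Prime) (L : Type) (_ : Field L) (_ : NumberField L),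
        BSTWScope.IsAuxiliaryPrime W p q ∧ BSTWScope.IsAuxiliaryField W p q L) →
      ∀ ε : ℤˣ, KobayashiMainConjecture W p ε := by
  intro W _ _ p _ h5 hsst hss _ ε
  by_cases hw : BSTWScope.HasWitness W p
  · exact hBSTW5 W p h5 hsst hss hw ε
  · refine hα W p h5 hsst hss (fun q hq L hF hN haux hfield => ?_) ε
    by_contra hndvd
    exact hw ⟨q, hq, L, hF, hN, haux, hfield, hndvd⟩

end Summit.BirchSwinnertonDyer.BirchSwinnertonDyer.Theorems

end
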